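import Literature.MathematicalPhysics.QuantumFieldTheory.Balaban1983to89.B12FormatPlus

/-!
# `Balaban1983to89.B12ChartGaugeFlow48` — T. Bałaban, *Renormalization group approach to lattice gauge field theories. I*, Commun. Math. Phys. **109** (1987)
# 249–301 [Balaban1987RG1], (4.7)–(4.8) pp. 282–283 and (1.10) p. 262: TWO HYPOTHESIS-FORM ROWS over the `B12FormatPlus` names — the CHART-LEVEL GAUGE FLOW
# `ChartGaugeFlow act coords χ gradLeg` ((4.8) in chart coordinates: every pure-gauge leg is the velocity at the origin of a one-parameter family of chart maps
# intertwined by the NAMED chart with the NAMED configuration action) and the CHART SYMMETRY `ChartSymm act χ n T` ((4.8) with a CONSTANT gauge function = (1.10):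
# a continuous linear map of the chart inputs intertwined GLOBALLY with the action of ONE named group element)

statement-level rows (Prop-valued definitions in HYPOTHESIS FORM, asserted for nothing) with citation tags; the two bookkeeping theorems are proved; nothing here is a
claim about the Yang–Mills mass gap.

PRINT.  p. 283, (4.8): *«(1∕i) log V^v = B + i[λ₋, B] − g⁻¹(i ad_B) ∂λ + …»* — the action of a gauge transformation `v = exp(iλ)` on the chart variable `B = (1∕i) log V`
of a bond variable, to first order a LATTICE GRADIENT of `λ` plus a commutator; p. 262, (1.10): *«U^u(b) = u(b₋)U(b)u(b₊)⁻¹, … 𝐉^u = R(u)𝐉»* — the configuration action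
(for a CONSTANT `u` the chart variable is conjugated: `exp(i Ad_u B) = u·exp(iB)·u⁻¹`); p. 284, (4.14)–(4.15): the Ward identities these rows feed
(`Summits/…/Theorems/BalabanUVNodesK0AxTransverseWard.lean`, the K0ᴬ decay road re-run on transverse response legs).

WHAT IS HERE (generic over `S : ℕ → LocDomainSys`, `M m : ℕ → ℕ`, a configuration action `act`, read coordinates `coords`, charts `χ`; pieces-free; beside
`B12FormatPlus.Ward414` ∕ `B12FormatPlus.ChartEquivariant`):
* `ChartGaugeFlow act coords χ gradLeg` — for every member `n` and gauge parameter `p : P n` a one-parameter family `γ t` in the named group and chart maps `φ t` with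
  `χ n X (φ t u) i = act n (γ t) (χ n X u) i` on `i ∈ coords n X` for `t`, `u` near `0`, `φ t` with a surjective derivative at `0` (near `t = 0`), `φ 0 0 = 0`, and
  `d∕dt|₀ φ t 0 = gradLeg n p`;
* `ChartSymm act χ n T` — `∃ g, ∀ X u, χ n X (T u) = act n g (χ n X u)`;
* `chartSymm_of_chartEquivariant` (every constant rotation of `B12FormatPlus.ChartEquivariant` is a chart symmetry), `chartSymm_one` (the identity, given a trivially
  acting group element) — non-vacuity ∕ compatibility bookkeeping.
DESIGN.  Hypothesis form (cell rule: the rows are DISPLAYED by their consumers, never asserted); `P n` is a free parameter type (at the record: ALL site functions into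
the colour algebra — refuter custody ◆ CRIT-1 g35 2026-08-31: a constrained sub-class would re-import a non-decaying gauge term).  NOT HERE: any inhabitant at a
record (that is a Summits-side theorem), any piece of the (1.19) mould, any estimate.  Typed by planner seat `ymgap-nodeO-lens-1` g7 (NODE v8∕v8.1, companion v2
`b4441b0d63812759`), custody-cut by refuter `ym-nodeO-crit-1` g35 (PASS ×4 + hosting word), landed by porter `ymgap-nodeO-port-PTB-1` g4 — 2026-08-31.
-/

noncomputable section

open scoped Topology
open Set Filter

namespace Literature.MathematicalPhysics.QuantumFieldTheory.Balaban1983to89.B12ChartGaugeFlow48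

variable {S : ℕ → LocDomainSys} {M m : ℕ → ℕ}

/-- **CHART-LEVEL GAUGE FLOW** ([I] (4.8) p. 283 in chart coordinates, hypothesis form): for every member `n` and every gauge parameter `p : P n`
(print: a gauge function `λ`), a one-parameter family `γ t` in the NAMED gauge group `Gg n` and a family `φ t` of maps of the chart inputs such that the
NAMED chart `χ n X` of EVERY domain intertwines `φ t` with the NAMED configuration action `act n (γ t)` ON THE COORDINATES `coords n X` THE PIECE READS
((1.7); the cut chart is `1 ∕ 0` off `X`, where a local gauge transformation is not trivial — irrelevant by input-locality), for `t` and the chart input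
near `0` ((4.8): `(1∕i) log V^v = B + i[λ₋, B] − g⁻¹(iad_B)∂λ + …`, a matrix logarithm near `1`), each `φ t` (for `t` near `0`) has a surjective derivative
at the chart origin, `φ 0` fixes the origin, and the orbit of the origin has velocity the NAMED pure-gauge leg `gradLeg n p` (print: `−∂λ`; at the
record's FLAT chart origin `(𝐔, 𝐉) = (1, 0)`: the lattice gradient on the `𝐔`-block, `0` on the `𝐉`-block).  Pieces-free; asserted for nothing.
[cite: Balaban1987RG1, (4.7)–(4.8) pp.282–283, (1.7) p.261, (1.10) p.262] -/
def ChartGaugeFlow {Gg P : ℕ → Type*} (act : (n : ℕ) → Gg n → (Fin (M n) → ℂ) → (Fin (M n) → ℂ))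
    (coords : (n : ℕ) → (S n).Dom → Finset (Fin (M n))) (χ : (n : ℕ) → (S n).Dom → (Fin (m n) → ℂ) → (Fin (M n) → ℂ))
    (gradLeg : (n : ℕ) → P n → (Fin (m n) → ℂ)) : Prop :=
  ∀ n (p : P n), ∃ (γ : ℝ → Gg n) (φ : ℝ → (Fin (m n) → ℂ) → (Fin (m n) → ℂ)) (L : ℝ → ((Fin (m n) → ℂ) →L[ℂ] (Fin (m n) → ℂ))),
    (∀ᶠ t in 𝓝 (0 : ℝ), ∀ X, ∀ᶠ u in 𝓝 (0 : Fin (m n) → ℂ), ∀ i ∈ coords n X, χ n X (φ t u) i = act n (γ t) (χ n X u) i) ∧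
    (∀ᶠ t in 𝓝 (0 : ℝ), HasFDerivAt (φ t) (L t) 0 ∧ Function.Surjective (L t)) ∧
    φ 0 0 = 0 ∧ HasDerivAt (fun t => φ t 0) (gradLeg n p) 0

/-- **CHART SYMMETRY** ([I] (4.8) p. 283 with a CONSTANT `λ`, i.e. (1.10) for constant gauge transformations, hypothesis form, pieces-free): a continuous
linear map `T` of the chart inputs of member `n` that EVERY chart `χ n X` intertwines, GLOBALLY, with the NAMED configuration action of ONE element of the
NAMED gauge group (print: `exp(i Ad_h B) = h·exp(iB)·h⁻¹`, `𝐉 ↦ h𝐉h⁻¹`; at the record: `recordAdJ h` with `recordToG h`, tree ✓ `BalabanUVNodesPortS1.chartEquivariantAtJ`).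
The legal form of «the honest legs may come out globally `Ad_{h₀}`-rotated» (the root's constant conjugation surviving the rooted gauge).  Asserted for nothing.
[cite: Balaban1987RG1, (4.8) p.283, (1.10) p.262] -/
def ChartSymm {Gg : ℕ → Type*} (act : (n : ℕ) → Gg n → (Fin (M n) → ℂ) → (Fin (M n) → ℂ))
    (χ : (n : ℕ) → (S n).Dom → (Fin (m n) → ℂ) → (Fin (M n) → ℂ)) (n : ℕ) (T : (Fin (m n) → ℂ) →L[ℂ] (Fin (m n) → ℂ)) : Prop :=
  ∃ g : Gg n, ∀ X u, χ n X (T u) = act n g (χ n X u)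

/-- Non-vacuity ∕ bookkeeping: under `B12FormatPlus.ChartEquivariant toG act χ A` every constant rotation `A n h` is a chart symmetry (witness `toG n h`).
[cite: Balaban1987RG1, (4.8) p.283, (1.10) p.262] -/
theorem chartSymm_of_chartEquivariant {Gg Hg : ℕ → Type*} {act : (n : ℕ) → Gg n → (Fin (M n) → ℂ) → (Fin (M n) → ℂ)}
    {χ : (n : ℕ) → (S n).Dom → (Fin (m n) → ℂ) → (Fin (M n) → ℂ)} {toG : (n : ℕ) → Hg n → Gg n}
    {A : (n : ℕ) → Hg n → ((Fin (m n) → ℂ) →L[ℂ] (Fin (m n) → ℂ))} (hEq : B12FormatPlus.ChartEquivariant toG act χ A) (n : ℕ) (h : Hg n) :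
    ChartSymm act χ n (A n h) :=
  ⟨toG n h, fun X u => hEq n X h u⟩

/-- Non-vacuity ∕ bookkeeping: the identity is a chart symmetry as soon as SOME named group element acts trivially (at the record: `1`).
[cite: Balaban1987RG1, (1.10) p.262 (u = 1)] -/
theorem chartSymm_one {Gg : ℕ → Type*} {act : (n : ℕ) → Gg n → (Fin (M n) → ℂ) → (Fin (M n) → ℂ)}
    {χ : (n : ℕ) → (S n).Dom → (Fin (m n) → ℂ) → (Fin (M n) → ℂ)} (n : ℕ) (e : Gg n) (he : ∀ u, act n e u = u) :
    ChartSymm act χ n 1 :=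
  ⟨e, fun X u => by rw [he]; rfl⟩

end Literature.MathematicalPhysics.QuantumFieldTheory.Balaban1983to89.B12ChartGaugeFlow48

end
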